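import Mathlib
import Literature.MathematicalPhysics.QuantumFieldTheory.Luscher2010.TrivializingMaps
import Literature.MathematicalPhysics.QuantumFieldTheory.Luscher2010.FlowActionSeries
import Summits.Ventures.LatticeQCDFlow.TrivializingMaps.TruncationDefect
import HarnessLib

/-!
# The flow-equation defect controls the pulled-back log-weight (Lüscher 2010 §4.1 made quantitative)

HONEST FRAMING: exact (Metropolis-corrected) sampling algorithms for lattice gauge theory; figures of merit are
autocorrelation/cost numbers at stated couplings and volumes; no continuum-physics claim.

Lüscher (§4.1) observes that the differential condition (4.3) on a flow generator, together with the flow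
equation (3.2), implies the integrated condition (4.1), hence (4.2): `S(𝓕_t V) - ln det 𝓕_{t*}(V)` is
field-independent and `𝓕_1` trivializes. This file proves the quantitative, APPROXIMATE version of that
implication for the gradient ansatz `Z_t = -∂S̃_t` (4.4), which is what a truncated or learned flow action
delivers (the venture's typed target `DefectControlsLogWeight`, `Truncation.lean` §3, is its measure-theoretic
packaging via the Jacobian formula (3.9)):

* §1 `linkDiv_neg_linkGrad`: the divergence of a gradient generator is Lüscher's Laplacian, `div(-∂f) = Δf`
  (coordinates `[-∂f]^a = -∂^a f` by the orthonormality (A.2)).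
* §2 calculus along flow lines: a flow line is a differentiable curve of ambient configurations
  (`isFlowLine_hasDerivAt_amb`); the chain rule `d/ds S(U_s) = -(𝓥_S S̃_s)(U_s)` (`hasDerivAt_comp_flowLine`);
  joint smoothness of `(t, W) ↦ ∂ S̃_t(W), Δ S̃_t(W), 𝓥 S̃_t(W), 𝓛_t S̃_t(W)` for a jointly smooth family
  (`contDiff_linkDeriv_param`, …, `contDiff_luscherL_param`).
* §3 `integral_linkDiv_flowLine`: `∫₀ᵗ div Z_s(U_s) ds = t S(U_t) + ∫₀ᵗ [(𝓛_s S̃_s)(U_s) - S(U_s)] ds` along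
  any flow line (fundamental theorem of calculus for `s ↦ s S(U_s)`), and the DEFECT BOUND
  `logWeight_osc_le_of_defect`: if `|(𝓛_t S̃_t)(U) - S(U) - Ċ_t| ≤ δ` on `[0,1] × SU(n)^E` then
  `R(V) = ∫₀¹ div Z_s(𝓕_s V) ds - S(𝓕_1 V)` (`= ln det 𝓕_{1*}(V) - S(𝓕_1 V)` by (3.9)) satisfies
  `|R(V) - R(V')| ≤ 2δ` — the pulled-back target differs from the Haar measure by a density of
  log-oscillation `≤ 2δ`. No regularity of `Ċ` is needed (it cancels).

All statements are over the declarations of `Luscher2010/TrivializingMaps.lean` (`linkDeriv`, `SuBasis`,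
`linkLap`, `linkDiv`, `linkGrad`, `luscherL`, `IsFlowLine`, `IsFlowMap`) and `Truncation.lean` (`luscherV`), and
reuse the link calculus of `TruncationDefect.lean` (`linkDeriv_eq_fderiv`, `contDiff_linkDeriv`,
`contDiff_pi_single_mul_apply`).

References: M. Lüscher, Trivializing maps, the Wilson flow and the HMC algorithm, CMP 293 (2010) 899
[Luscher2010Trivializing, arXiv:0907.5491], §3.1 eq. (3.2), §3.2 eq. (3.9), §4.1 eqs. (4.1)–(4.3), §4.2
eqs. (4.4)–(4.6), App. A eqs. (A.2)–(A.4), (A.10).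
-/

namespace Summit.Ventures.LatticeQCDFlow.TrivializingMaps

open MeasureTheory
open Literature.MathematicalPhysics.QuantumFieldTheory
open Literature.MathematicalPhysics.QuantumFieldTheory.Luscher2010
open scoped Matrix Matrix.Norms.Frobenius ContDiff

variable {d L n : ℕ}

/-! ## §1. The gradient generator `Z = -∂f`: coordinates and divergence -/

section GradientGenerator

/-- Coordinates of a basis expansion: `(∑_b c_b T^b)^a = c_a` (orthonormality (A.2) with (A.10)).
[cite: Luscher2010Trivializing, App. A eqs. (A.2), (A.10)] -/
theorem suBasis_coord_sum_smul (B : SuBasis n) (c : B.ι → ℝ) (a : B.ι) :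
    B.coord a (∑ b, ((c b : ℝ) : ℂ) • B.T b) = c a := by
  have h : (B.T a * ∑ b, ((c b : ℝ) : ℂ) • B.T b).trace = ((c a : ℝ) : ℂ) * (-(1 / 2 : ℂ)) := by
    rw [Finset.mul_sum, Matrix.trace_sum]
    simp_rw [Matrix.mul_smul, Matrix.trace_smul, B.orth, smul_eq_mul, mul_ite, mul_zero]
    rw [Finset.sum_ite_eq]
    simp
  unfold SuBasis.coord
  rw [h, show ((c a : ℝ) : ℂ) * (-(1 / 2 : ℂ)) = ((c a * (-(1 / 2)) : ℝ) : ℂ) by push_cast; ring,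
    Complex.ofReal_re]
  ring

/-- The gradient generator in coordinates: `-∂f (W)(e) = ∑_a (-∂^a_e f(W)) T^a`.
[cite: Luscher2010Trivializing, §4.2 eq. (4.4)] -/
theorem neg_linkGrad_apply (B : SuBasis n) (f : AmbConfig d L n → ℝ) (W : AmbConfig d L n) (e : Edge d L) :
    (-linkGrad B f W) e = ∑ a, (((-linkDeriv e (B.T a) f W : ℝ)) : ℂ) • B.T a := by
  show -(∑ a, ((linkDeriv e (B.T a) f W : ℝ) : ℂ) • B.T a) = _
  rw [← Finset.sum_neg_distrib]
  refine Finset.sum_congr rfl fun a _ => ?_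
  rw [Complex.ofReal_neg, neg_smul]

/-- `[-∂f]^a_e = -∂^a_e f`. [cite: Luscher2010Trivializing, §4.2 eq. (4.4), App. A eq. (A.10)] -/
theorem suBasis_coord_neg_linkGrad (B : SuBasis n) (f : AmbConfig d L n → ℝ) (W : AmbConfig d L n)
    (e : Edge d L) (a : B.ι) : B.coord a ((-linkGrad B f W) e) = -linkDeriv e (B.T a) f W := by
  rw [neg_linkGrad_apply, suBasis_coord_sum_smul]

/-- `∂_{e,X}` commutes with negation (no differentiability needed). [folklore] -/
theorem linkDeriv_neg' (e : Edge d L) (X : Matrix (Fin n) (Fin n) ℂ) (f : AmbConfig d L n → ℝ)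
    (W : AmbConfig d L n) : linkDeriv e X (fun W' => -f W') W = -linkDeriv e X f W := by
  unfold linkDeriv
  exact deriv.fun_neg

/-- **The divergence of a gradient generator is Lüscher's Laplacian**: `∑ ∂^a [-∂f]^a = -∑ ∂^a∂^a f = Δ f`
(the integrand of the Jacobian formula (3.9) for the ansatz (4.4) is the first term of (4.6)).
[cite: Luscher2010Trivializing, §3.2 eq. (3.9), §4.2 eqs. (4.4)–(4.6)] -/
theorem linkDiv_neg_linkGrad [NeZero L] (B : SuBasis n) (f : AmbConfig d L n → ℝ) (W : AmbConfig d L n) :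
    linkDiv B (fun W' => -linkGrad B f W') W = linkLap B f W := by
  unfold linkDiv linkLap
  simp only [suBasis_coord_neg_linkGrad, linkDeriv_neg', Finset.sum_neg_distrib]

end GradientGenerator

/-! ## §2. Calculus along flow lines of a gradient generator -/

section FlowLineCalculus

/-- A flow line (3.2), stated entrywise in `IsFlowLine`, assembled into a curve of ambient configurations:
`U̇_t = Z_t(U_t) U_t`. [cite: Luscher2010Trivializing, §3.1 eq. (3.2)] -/
theorem isFlowLine_hasDerivAt_amb {Z : Generator d L n} {U : ℝ → AmbConfig d L n} (hU : IsFlowLine Z U)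
    (t : ℝ) : HasDerivAt U (fun e => Z t (U t) e * U t e) t :=
  hasDerivAt_pi.2 fun e => WilsonFlow.hasDerivAt_of_entries fun i j => hU t e i j

variable [NeZero L]

/-- The graph `s ↦ (s, U_s)` of a flow line is a differentiable (hence continuous) curve in `ℝ × M_n(ℂ)^E`
(used to evaluate jointly smooth quantities along the flow). [folklore] -/
theorem isFlowLine_hasDerivAt_graph {Z : Generator d L n} {U : ℝ → AmbConfig d L n} (hU : IsFlowLine Z U)
    (t : ℝ) : HasDerivAt (fun s : ℝ => (s, U s)) ((1 : ℝ), fun e => Z t (U t) e * U t e) t :=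
  (hasDerivAt_id' t).prodMk (isFlowLine_hasDerivAt_amb hU t)

/-- The Fréchet derivative applied to a Lie-algebra-valued left-invariant tangent field, in link coordinates:
`DS(W)[e ↦ (∑_a c_{e,a} T^a) W(e)] = ∑_{e,a} c_{e,a} ∂^a_e S(W)` (eq. (A.3) summed over links).
[cite: Luscher2010Trivializing, App. A eqs. (A.3)–(A.4)] -/
theorem fderiv_apply_sum_smul_mul (B : SuBasis n) {S : AmbConfig d L n → ℝ} {W : AmbConfig d L n}
    (hS : DifferentiableAt ℝ S W) (c : Edge d L → B.ι → ℝ) :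
    fderiv ℝ S W (fun e => (∑ a, ((c e a : ℝ) : ℂ) • B.T a) * W e) =
      ∑ e, ∑ a, c e a * linkDeriv e (B.T a) S W := by
  have hv : (fun e => (∑ a, ((c e a : ℝ) : ℂ) • B.T a) * W e) =
      ∑ e, ∑ a, c e a • (Pi.single e (B.T a * W e) : AmbConfig d L n) := by
    funext e'
    simp only [Finset.sum_apply, Pi.smul_apply, Pi.single_apply, smul_ite, smul_zero]
    rw [Finset.sum_comm]
    simp only [Finset.sum_ite_eq, Finset.mem_univ, if_true, Finset.sum_mul]
    refine Finset.sum_congr rfl fun a _ => ?_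
    rw [Complex.coe_smul, smul_mul_assoc]
  rw [hv, map_sum]
  refine Finset.sum_congr rfl fun e _ => ?_
  rw [map_sum]
  refine Finset.sum_congr rfl fun a _ => ?_
  rw [map_smul, smul_eq_mul, linkDeriv_eq_fderiv hS e (B.T a)]

/-- **Chain rule along a gradient flow line**: if `U̇_s = -∂S̃_s(U_s) U_s` then
`d/ds S(U_s) = -∑ (∂^a S)(∂^a S̃_s) (U_s) = -(𝓥_S S̃_s)(U_s)`.
[cite: Luscher2010Trivializing, §4.1 (derivation of (4.2)–(4.3)), App. A eq. (A.3)] -/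
theorem hasDerivAt_comp_flowLine (B : SuBasis n) {S : AmbConfig d L n → ℝ} (hS : ContDiff ℝ ∞ S)
    (F : ℝ → AmbConfig d L n → ℝ) {U : ℝ → AmbConfig d L n}
    (hU : IsFlowLine (fun t W => -linkGrad B (F t) W) U) (t : ℝ) :
    HasDerivAt (fun s => S (U s)) (-luscherV B S (F t) (U t)) t := by
  have h1 : HasDerivAt U (fun e => (-linkGrad B (F t) (U t)) e * U t e) t :=
    isFlowLine_hasDerivAt_amb hU t
  have h2 : HasDerivAt (fun s => S (U s))
      (fderiv ℝ S (U t) (fun e => (-linkGrad B (F t) (U t)) e * U t e)) t :=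
    (hS.differentiable (by simp) (U t)).hasFDerivAt.comp_hasDerivAt t h1
  refine h2.congr_deriv ?_
  have hv : (fun e => (-linkGrad B (F t) (U t)) e * U t e) =
      fun e => (∑ a, (((-linkDeriv e (B.T a) (F t) (U t) : ℝ)) : ℂ) • B.T a) * U t e := by
    funext e
    rw [neg_linkGrad_apply]
  rw [hv, fderiv_apply_sum_smul_mul B ((hS.differentiable (by simp)) (U t))]
  unfold luscherV
  simp only [neg_mul, Finset.sum_neg_distrib, neg_inj]
  exact Finset.sum_congr rfl fun e _ => Finset.sum_congr rfl fun a _ => mul_comm _ _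

/-- **Joint smoothness is preserved by `∂_{e,X}`**: if `(t, W) ↦ F_t(W)` is smooth then so is
`(t, W) ↦ ∂_{e,X} F_t (W) = D F_t(W)[δ_e X W(e)]` (what App. E's "differentiable in `t` and `U`" feeds into
the flow calculus). [cite: Luscher2010Trivializing, App. A eq. (A.3), App. E] -/
theorem contDiff_linkDeriv_param {F : ℝ → AmbConfig d L n → ℝ}
    (hF : ContDiff ℝ ∞ fun p : ℝ × AmbConfig d L n => F p.1 p.2) (e : Edge d L)
    (X : Matrix (Fin n) (Fin n) ℂ) :
    ContDiff ℝ ∞ fun p : ℝ × AmbConfig d L n => linkDeriv e X (F p.1) p.2 := by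
  have hsl : ∀ t, ContDiff ℝ ∞ (F t) := fun t => hF.comp (contDiff_const.prodMk contDiff_id)
  have heq : (fun p : ℝ × AmbConfig d L n => linkDeriv e X (F p.1) p.2) =
      fun p => fderiv ℝ (F p.1) p.2 (Pi.single e (X * p.2 e)) :=
    funext fun p => linkDeriv_eq_fderiv ((hsl p.1).differentiable (by simp) p.2) e X
  rw [heq]
  have hunc : ContDiff ℝ ∞
      (Function.uncurry fun (p : ℝ × AmbConfig d L n) (W : AmbConfig d L n) => F p.1 W) :=
    hF.comp ((contDiff_fst.comp contDiff_fst).prodMk contDiff_snd)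
  exact hunc.fderiv_apply contDiff_snd ((contDiff_pi_single_mul_apply e X).comp contDiff_snd) le_rfl

/-- `(t, W) ↦ Δ F_t (W)` is smooth for a jointly smooth family. [cite: Luscher2010Trivializing, §4.2 eq. (4.6), App. E] -/
theorem contDiff_linkLap_param (B : SuBasis n) {F : ℝ → AmbConfig d L n → ℝ}
    (hF : ContDiff ℝ ∞ fun p : ℝ × AmbConfig d L n => F p.1 p.2) :
    ContDiff ℝ ∞ fun p : ℝ × AmbConfig d L n => linkLap B (F p.1) p.2 := by
  unfold linkLap
  refine ContDiff.neg (ContDiff.sum fun e _ => ContDiff.sum fun a _ => ?_)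
  exact contDiff_linkDeriv_param (F := fun t => linkDeriv e (B.T a) (F t))
    (contDiff_linkDeriv_param hF e (B.T a)) e (B.T a)

/-- `(t, W) ↦ 𝓥_S F_t (W)` is smooth for smooth `S` and a jointly smooth family.
[cite: Luscher2010Trivializing, §4.2 eq. (4.6), App. E] -/
theorem contDiff_luscherV_param (B : SuBasis n) {S : AmbConfig d L n → ℝ} (hS : ContDiff ℝ ∞ S)
    {F : ℝ → AmbConfig d L n → ℝ} (hF : ContDiff ℝ ∞ fun p : ℝ × AmbConfig d L n => F p.1 p.2) :
    ContDiff ℝ ∞ fun p : ℝ × AmbConfig d L n => luscherV B S (F p.1) p.2 := by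
  unfold luscherV
  refine ContDiff.sum fun e _ => ContDiff.sum fun a _ => ?_
  exact ((contDiff_linkDeriv hS e (B.T a)).comp contDiff_snd).mul (contDiff_linkDeriv_param hF e (B.T a))

/-- `(t, W) ↦ 𝓛_t F_t (W)` is smooth. [cite: Luscher2010Trivializing, §4.2 eq. (4.6), App. E] -/
theorem contDiff_luscherL_param (B : SuBasis n) {S : AmbConfig d L n → ℝ} (hS : ContDiff ℝ ∞ S)
    {F : ℝ → AmbConfig d L n → ℝ} (hF : ContDiff ℝ ∞ fun p : ℝ × AmbConfig d L n => F p.1 p.2) :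
    ContDiff ℝ ∞ fun p : ℝ × AmbConfig d L n => luscherL B S p.1 (F p.1) p.2 := by
  simp only [luscherL_eq]
  exact (contDiff_linkLap_param B hF).add (contDiff_fst.mul (contDiff_luscherV_param B hS hF))

end FlowLineCalculus

/-! ## §3. The log-Jacobian identity along gradient flows and the defect bound on the pulled-back log-weight -/

section LogWeight

variable [NeZero L]

/-- **Flow equation + (differential) flow condition ⇒ integrated condition, in defect form** (Lüscher §4.1:
"the differential condition (4.3) and the flow equation (3.2) imply eq. (4.1)"), for the gradient ansatz
`Z_t = -∂S̃_t` (4.4): along ANY flow line `U_s` of `-∂S̃_s`, for smooth `S` and jointly smooth `S̃`,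
`∫₀ᵗ div Z_s(U_s) ds = t·S(U_t) + ∫₀ᵗ [(𝓛_s S̃_s)(U_s) - S(U_s)] ds`.
(`div(-∂S̃_s) = ΔS̃_s = 𝓛_sS̃_s - s𝓥S̃_s` and `d/ds S(U_s) = -𝓥S̃_s(U_s)`, then the fundamental theorem of
calculus for `s ↦ s·S(U_s)`.) With (3.9) the left side is `ln det 𝓕_{t*}(V)`; if `𝓛_sS̃_s = S + Ċ_s` exactly
this is (4.1)/(4.2). [cite: Luscher2010Trivializing, §3.2 eq. (3.9), §4.1 eqs. (4.1)–(4.3), §4.2 eqs. (4.4)–(4.6)] -/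
theorem integral_linkDiv_flowLine (B : SuBasis n) {S : AmbConfig d L n → ℝ} (hS : ContDiff ℝ ∞ S)
    {F : ℝ → AmbConfig d L n → ℝ} (hF : ContDiff ℝ ∞ fun p : ℝ × AmbConfig d L n => F p.1 p.2)
    {U : ℝ → AmbConfig d L n} (hU : IsFlowLine (fun t W => -linkGrad B (F t) W) U) (t : ℝ) :
    ∫ s in (0 : ℝ)..t, linkDiv B (fun W => -linkGrad B (F s) W) (U s) =
      t * S (U t) + ∫ s in (0 : ℝ)..t, (luscherL B S s (F s) (U s) - S (U s)) := by
  -- continuity along the flow line, obtained in the normed topology from differentiability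
  have hUc := continuous_iff_continuousAt.2 fun s => (isFlowLine_hasDerivAt_amb hU s).continuousAt
  have hpair := continuous_iff_continuousAt.2 fun s => (isFlowLine_hasDerivAt_graph hU s).continuousAt
  have hcV := (contDiff_luscherV_param B hS hF).continuous.comp hpair
  have hcL := (contDiff_luscherL_param B hS hF).continuous.comp hpair
  have hcS := hS.continuous.comp hUc
  have hder : ∀ s, HasDerivAt (fun s => s * S (U s))
      (1 * S (U s) + s * (-luscherV B S (F s) (U s))) s :=
    fun s => (hasDerivAt_id' s).mul (hasDerivAt_comp_flowLine B hS F hU s)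
  have hi1 : IntervalIntegrable (fun s => 1 * S (U s) + s * (-luscherV B S (F s) (U s))) volume 0 t :=
    ((continuous_const.mul hcS).add (continuous_id.mul hcV.neg)).intervalIntegrable _ _
  have hi2 : IntervalIntegrable (fun s => luscherL B S s (F s) (U s) - S (U s)) volume 0 t :=
    (hcL.sub hcS).intervalIntegrable _ _
  have hFTC : ∫ s in (0 : ℝ)..t, (1 * S (U s) + s * (-luscherV B S (F s) (U s))) =
      t * S (U t) - 0 * S (U 0) :=
    intervalIntegral.integral_eq_sub_of_hasDerivAt (fun s _ => hder s) hi1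
  have hsplit : ∀ s, linkDiv B (fun W => -linkGrad B (F s) W) (U s) =
      (1 * S (U s) + s * (-luscherV B S (F s) (U s))) + (luscherL B S s (F s) (U s) - S (U s)) := by
    intro s
    rw [linkDiv_neg_linkGrad, luscherL_eq]
    ring
  simp_rw [hsplit]
  rw [intervalIntegral.integral_add hi1 hi2, hFTC]
  ring

/-- Two reals within `δ` of a common third are within `2δ` of each other. [folklore] -/
private theorem abs_sub_le_two_mul {x y z δ : ℝ} (hx : |x - z| ≤ δ) (hy : |y - z| ≤ δ) :
    |x - y| ≤ 2 * δ := by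
  rw [abs_le] at hx hy ⊢
  constructor <;> linarith [hx.1, hx.2, hy.1, hy.2]

/-- **The flow-equation defect controls the pulled-back log-weight** (OURS; the analytic half of the typed
target `DefectControlsLogWeight`, Lüscher's (4.3) ⇒ (4.2) made quantitative): let `Φ` be an integrated
transformation of the gradient generator `Z_t = -∂S̃_t` (`S`, `S̃` smooth) and suppose the defect of the
trivializing-flow equation (4.5) is uniformly small on the field manifold,
`|(𝓛_t S̃_t)(U) - S(U) - Ċ_t| ≤ δ` for `t ∈ [0,1]`, `U ∈ SU(n)^E`, for SOME function `Ċ` (no regularity of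
`Ċ` is needed: it cancels). Then the quantity `R(V) = ∫₀¹ div Z_s(𝓕_s V) ds - S(𝓕_1 V)` — by (3.9),
`R(V) = ln det 𝓕_{1*}(V) - S(𝓕_1(V))`, minus the effective action of the pulled-back target — oscillates by
at most `2δ` over the field manifold: `|R(V) - R(V')| ≤ 2δ`. (For an exact solution, `δ = 0`, this is (4.2)
at `t = 1`: the pulled-back action is constant, i.e. `𝓕_1` trivializes.) Consequently the model density of
`(𝓕_1)_* D[V]` relative to `𝒵⁻¹e^{-S}D[U]` has log-oscillation `≤ 2δ` and the Metropolis acceptance /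
importance weights are controlled by `e^{-2δ}` — the measure-theoretic packaging is `DefectControlsLogWeight`.
[cite: Luscher2010Trivializing, §3.2 eq. (3.9), §4.1 eqs. (4.1)–(4.3), §4.2 eqs. (4.4)–(4.6)] -/
theorem logWeight_osc_le_of_defect (B : SuBasis n) {S : AmbConfig d L n → ℝ} (hS : ContDiff ℝ ∞ S)
    {F : ℝ → AmbConfig d L n → ℝ} (hF : ContDiff ℝ ∞ fun p : ℝ × AmbConfig d L n => F p.1 p.2)
    {Φ : ℝ → GaugeConfig d L (Matrix.specialUnitaryGroup (Fin n) ℂ) → GaugeConfig d L (Matrix.specialUnitaryGroup (Fin n) ℂ)}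
    (hΦ : IsFlowMap (fun t W => -linkGrad B (F t) W) Φ) {c : ℝ → ℝ} {δ : ℝ}
    (hδ : ∀ t ∈ Set.Icc (0 : ℝ) 1, ∀ U : GaugeConfig d L (Matrix.specialUnitaryGroup (Fin n) ℂ),
      |luscherL B S t (F t) (WilsonFlow.coeConfig U) - S (WilsonFlow.coeConfig U) - c t| ≤ δ)
    (V V' : GaugeConfig d L (Matrix.specialUnitaryGroup (Fin n) ℂ)) :
    |((∫ s in (0 : ℝ)..1, linkDiv B (fun W => -linkGrad B (F s) W) (WilsonFlow.coeConfig (Φ s V))) -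
        S (WilsonFlow.coeConfig (Φ 1 V))) -
      ((∫ s in (0 : ℝ)..1, linkDiv B (fun W => -linkGrad B (F s) W) (WilsonFlow.coeConfig (Φ s V'))) -
        S (WilsonFlow.coeConfig (Φ 1 V')))| ≤ 2 * δ := by
  have hid : ∀ V₀ : GaugeConfig d L (Matrix.specialUnitaryGroup (Fin n) ℂ),
      (∫ s in (0 : ℝ)..1, linkDiv B (fun W => -linkGrad B (F s) W) (WilsonFlow.coeConfig (Φ s V₀))) -
          S (WilsonFlow.coeConfig (Φ 1 V₀)) =
        ∫ s in (0 : ℝ)..1, (luscherL B S s (F s) (WilsonFlow.coeConfig (Φ s V₀)) -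
          S (WilsonFlow.coeConfig (Φ s V₀))) := by
    intro V₀
    rw [integral_linkDiv_flowLine B hS hF (hΦ.2 V₀) 1, one_mul]
    ring
  have hcont : ∀ V₀ : GaugeConfig d L (Matrix.specialUnitaryGroup (Fin n) ℂ), Continuous fun s =>
      luscherL B S s (F s) (WilsonFlow.coeConfig (Φ s V₀)) - S (WilsonFlow.coeConfig (Φ s V₀)) := by
    intro V₀
    have hUc := continuous_iff_continuousAt.2 fun s => (isFlowLine_hasDerivAt_amb (hΦ.2 V₀) s).continuousAt
    have hpair := continuous_iff_continuousAt.2 fun s =>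
      (isFlowLine_hasDerivAt_graph (hΦ.2 V₀) s).continuousAt
    exact ((contDiff_luscherL_param B hS hF).continuous.comp hpair).sub (hS.continuous.comp hUc)
  rw [hid V, hid V', ← intervalIntegral.integral_sub ((hcont V).intervalIntegrable _ _)
    ((hcont V').intervalIntegrable _ _)]
  have hb := intervalIntegral.norm_integral_le_of_norm_le_const (a := (0 : ℝ)) (b := 1) (C := 2 * δ)
    (f := fun s => (luscherL B S s (F s) (WilsonFlow.coeConfig (Φ s V)) - S (WilsonFlow.coeConfig (Φ s V))) -
      (luscherL B S s (F s) (WilsonFlow.coeConfig (Φ s V')) - S (WilsonFlow.coeConfig (Φ s V'))))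
    (fun s hs => by
      have hs' : s ∈ Set.Icc (0 : ℝ) 1 := by
        rw [Set.uIoc_of_le zero_le_one] at hs
        exact Set.Ioc_subset_Icc_self hs
      rw [Real.norm_eq_abs]
      exact abs_sub_le_two_mul (hδ s hs' (Φ s V)) (hδ s hs' (Φ s V')))
  rw [sub_zero, abs_one, mul_one, Real.norm_eq_abs] at hb
  exact hb

end LogWeight

end Summit.Ventures.LatticeQCDFlow.TrivializingMaps
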